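import Mathlib
import Summits.ResolutionOfSingularities.ResolutionOfSingularities.Theorems.WeightedInvariantLocalWeightedDropWildMonicFlagBound
import Summits.ResolutionOfSingularities.ResolutionOfSingularities.Theorems.WeightedInvariantLocalWeightedDropWildMonicWCleanStep

/-!
# `WeightedInvariant.LocalWeightedDrop`, line `hasse-ridge-face-selection`, S3ρ sub-stub S3ρD: item D-0 «a maximising flag exists» —
# three computations with the Taylor shift of a tuple: the `q`-SLOT in degree `q`, `x_i`-DIVISIBILITY under `x_i`-multiple shifts, and
# CORNER ELIMINATION by the monomial re-centring `y ↦ y + μ x^v`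

Crux item stmt-ResolutionOfSingularities-8899 `LocalWeightedDrop` (route `ResolutionOfSingularities/WeightedInvariant`), engine of the
door `HypersurfaceCentreConstruction` stmt-ResolutionOfSingularities-19897.  [OURS · L1 W4.3, chain w43, res-L1-w43-stub-1 (gen 4) =
second hand on roadmap item D-0 under the S3ρ owners res-type-083 / stub-7 and the D-0 holder res-L1-w43-stub-3; plan
`L/res-L1-w43-stub-1/HPOS-PLAN.md` (hbounds (i): «a valid `n = 0` flag with `d_𝓕 > 0` off the exits»), file F2 of its cut.  The shift
formula is res-type-083's `WildMonic.shift_eq` (`shift d A g j = C(d,j) g^{d−j} + Σ_l C(l,j) A_l g^{l−j}`, Perlega Lemma 5.3.1 shape) and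
the binomial facts `C(d, ·) mod p` are res-type-083's `…WildMonicShiftOrder`.  Nothing here is a statement of H. Hironaka's manuscript;
every object is OURS.]

* `coeff_single_qOf_shift_qSlot` — at a POSITION `A`, for a re-centring `g(0) = 0` with linear part `c₀x₀ + c₁x₁`, the degree-`q`
  coefficient of the `q`-slot (`q = p^{v_p d}`, slot `d − q`, `C(d, d−q) ≠ 0`) of `shift d A g` at `x_i^q` is `C(d,d−q)·c_i^q`
  (Frobenius on the linear part; every other contribution has order `> q`); hence `single_factorial_mem_newtonSet_shift`: `c_i ≠ 0`
  puts the axis point `d!·e_i` into the scaled Newton set of `shift d A g`.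
* `X_pow_dvd_shift` — if `x_i^{(d−j)m} ∣ B_j` for all slots and `x_i^m ∣ γ`, then `x_i^{(d−j)m} ∣ (shift d B γ)_j` for all slots.
* `shift_binomialTuple_neg_eq_zero` — the tuple of `(y + c)^d` re-centred by `−c` is the zero tuple (`((Y − c) + c)^d = Y^d`);
  `shift_add_apply` — the shift is affine in the tuple; and **`corner_elimination`**: if every monomial `β` of `B_l` dominates `(d−l)·v`
  and the corner coefficients are `C(d,l)(−μ)^{d−l}` (the `v`-corner part of `y^d + Σ B_l y^l` is `(y − μx^v)^d`), then after the
  re-centring `y ↦ y + μ x^v` every monomial of every slot `j` STRICTLY dominates `(d−j)·v` — the corner is gone and nothing appears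
  below it.  Plus the dictionary `factorial_smul_le_slotWeight_smul_iff` / `…_eq_…` between scaled points and exponents.
AI-written; gate-accepted means sorry-free with standard axioms, not refereed.
-/

set_option linter.dupNamespace false -- mandated namespace of this single-conjunct summit

noncomputable section

namespace Summit.ResolutionOfSingularities.ResolutionOfSingularities.Theorems

namespace WildMonic

open MvPowerSeries MonicDescent

variable {k : Type} [Field k] {d : ℕ}

/-! ### Scaled points versus exponents -/

/-- `d!·v ≤ (d!/(d−j))·β` iff `(d−j)·v ≤ β` (componentwise). -/
theorem factorial_smul_le_slotWeight_smul_iff (j : Fin d) (v β : Fin 2 →₀ ℕ) :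
    d.factorial • v ≤ slotWeight d j • β ↔ (d - (j : ℕ)) • v ≤ β := by
  have hw := slotWeight_mul_sub j
  have hwpos := slotWeight_pos j
  simp only [Finsupp.le_def, Finsupp.smul_apply, smul_eq_mul]
  refine forall_congr' fun i => ?_
  rw [← hw, mul_assoc]
  exact Nat.mul_le_mul_left_iff hwpos

/-- `d!·v = (d!/(d−j))·β` iff `(d−j)·v = β`. -/
theorem factorial_smul_eq_slotWeight_smul_iff (j : Fin d) (v β : Fin 2 →₀ ℕ) :
    d.factorial • v = slotWeight d j • β ↔ (d - (j : ℕ)) • v = β := by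
  have hw := slotWeight_mul_sub j
  have hwpos := slotWeight_pos j
  constructor
  · intro h
    ext i
    have hi := congrArg (fun f : Fin 2 →₀ ℕ => f i) h
    simp only [Finsupp.smul_apply, smul_eq_mul] at hi ⊢
    rw [← hw, mul_assoc] at hi
    exact Nat.eq_of_mul_eq_mul_left hwpos hi
  · intro h
    rw [← h]
    ext i
    simp only [Finsupp.smul_apply, smul_eq_mul]
    rw [← hw, mul_assoc]

/-! ### The `q`-slot in degree `q` -/

/-- The linear part of a series with no constant term leaves a remainder of order `≥ 2`. -/
theorem two_le_order_sub_linear {g : MvPowerSeries (Fin 2) k} (hg : constantCoeff g = 0) :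
    (2 : ℕ∞) ≤ (g - (C (coeff (Finsupp.single 0 1) g) * X 0 + C (coeff (Finsupp.single 1 1) g) * X 1)).order := by
  rw [Literature.AlgebraicGeometry.Resolution.FormalCoordChange.two_le_order_iff]
  refine ⟨?_, fun i => ?_⟩
  · simp [hg]
  · fin_cases i <;> simp [coeff_X, Finsupp.single_eq_single_iff]

/-- At a position, the sum `Σ_l C(l,j) A_l g^{l−j}` of the shift formula has order `> d − j` (for `g(0) = 0`). -/
theorem sub_lt_order_shift_sum {A : Fin d → MvPowerSeries (Fin 2) k} (hA : IsPos d A) {g : MvPowerSeries (Fin 2) k}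
    (hg : constantCoeff g = 0) (j : Fin d) :
    ((d - (j : ℕ) : ℕ) : ℕ∞) < (∑ l : Fin d, (((l : ℕ).choose j : ℕ) : MvPowerSeries (Fin 2) k) * A l * g ^ ((l : ℕ) - j)).order := by
  have hsucc : (((d - (j : ℕ) : ℕ) : ℕ∞) + 1) ≤
      (∑ l : Fin d, (((l : ℕ).choose j : ℕ) : MvPowerSeries (Fin 2) k) * A l * g ^ ((l : ℕ) - j)).order := by
    refine le_weightedOrder_finset_sum (fun _ => 1) _ _ fun l _ => ?_
    show ((d - (j : ℕ) : ℕ) : ℕ∞) + 1 ≤ ((((l : ℕ).choose j : ℕ) : MvPowerSeries (Fin 2) k) * A l * g ^ ((l : ℕ) - j)).order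
    by_cases hlj : (l : ℕ) < j
    · rw [Nat.choose_eq_zero_of_lt hlj, Nat.cast_zero, zero_mul, zero_mul, order_zero]
      exact le_top
    · push Not at hlj
      have h1 : ((d - (l : ℕ) : ℕ) : ℕ∞) + 1 ≤ (A l).order := Order.add_one_le_of_lt (hA l)
      have h2 : (((l : ℕ) - j : ℕ) : ℕ∞) ≤ (g ^ ((l : ℕ) - j)).order := le_order_pow_of_constantCoeff_eq_zero _ hg
      calc ((d - (j : ℕ) : ℕ) : ℕ∞) + 1 = (((d - (l : ℕ) : ℕ) : ℕ∞) + 1) + (((l : ℕ) - j : ℕ) : ℕ∞) := by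
            have hl := l.2
            rw [add_right_comm, ← Nat.cast_add]
            congr 2
            omega
        _ ≤ (A l).order + (g ^ ((l : ℕ) - j)).order := add_le_add h1 h2
        _ ≤ (A l * g ^ ((l : ℕ) - j)).order := le_order_mul
        _ ≤ ((((l : ℕ).choose j : ℕ) : MvPowerSeries (Fin 2) k)).order + (A l * g ^ ((l : ℕ) - j)).order := le_add_self
        _ ≤ _ := by rw [mul_assoc]; exact le_order_mul
  exact lt_of_lt_of_le (ENat.lt_add_one_iff (ENat.coe_ne_top _) |>.mpr le_rfl) hsucc

section QSlot

variable (p : ℕ) [Fact p.Prime] [CharP k p]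

/-- **THE `q`-SLOT IN DEGREE `q`**: at a position `A`, for `g(0) = 0` with `c_i := [x_i] g`, the coefficient of `x_i^q` in the slot
`d − q` of `shift d A g` is `C(d, d−q)·c_i^q` (`q = p^{v_p d}`). -/
theorem coeff_single_qOf_shift_qSlot (hd : 0 < d) {A : Fin d → MvPowerSeries (Fin 2) k} (hA : IsPos d A)
    {g : MvPowerSeries (Fin 2) k} (hg : constantCoeff g = 0) (i : Fin 2) :
    coeff (Finsupp.single i (qOf p d)) (shift d A g (qSlot p d hd)) =
      ((d.choose (d - qOf p d) : ℕ) : k) * (coeff (Finsupp.single i 1) g) ^ qOf p d := by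
  have hq := qOf_pos p d
  have hqd : qOf p d ≤ d := Nat.le_of_dvd hd (qOf_dvd p d)
  have hjq : ((qSlot p d hd : Fin d) : ℕ) = d - qOf p d := rfl
  have hdj : d - ((qSlot p d hd : Fin d) : ℕ) = qOf p d := by rw [hjq]; omega
  rw [shift_eq, map_add, hdj, hjq]
  -- the sum has order `> q`
  have hsum : coeff (Finsupp.single i (qOf p d))
      (∑ l : Fin d, (((l : ℕ).choose (d - qOf p d) : ℕ) : MvPowerSeries (Fin 2) k) * A l * g ^ ((l : ℕ) - (d - qOf p d))) = 0 := by
    apply coeff_of_lt_order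
    have h := sub_lt_order_shift_sum hA hg (qSlot p d hd)
    rw [hdj] at h
    simpa [Finsupp.degree_single] using h
  rw [hsum, add_zero, ← map_natCast (C : k →+* MvPowerSeries (Fin 2) k), coeff_C_mul]
  congr 1
  -- `g^q` by Frobenius on the linear part
  haveI : CharP (MvPowerSeries (Fin 2) k) p :=
    charP_of_injective_ringHom (algebraMap k (MvPowerSeries (Fin 2) k)).injective p
  set c₀ := coeff (Finsupp.single 0 1) g with hc₀
  set c₁ := coeff (Finsupp.single 1 1) g with hc₁
  set g₂ := g - (C c₀ * X 0 + C c₁ * X 1) with hg₂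
  have h2 : (2 : ℕ∞) ≤ g₂.order := two_le_order_sub_linear hg
  have hgsplit : g = (C c₀ * X 0 + C c₁ * X 1) + g₂ := by rw [hg₂]; ring
  have hpow : g ^ qOf p d = C (c₀ ^ qOf p d) * X 0 ^ qOf p d + C (c₁ ^ qOf p d) * X 1 ^ qOf p d + g₂ ^ qOf p d := by
    rw [hgsplit]
    unfold qOf
    rw [add_pow_char_pow, add_pow_char_pow, mul_pow, mul_pow, ← map_pow (C : k →+* MvPowerSeries (Fin 2) k),
      ← map_pow (C : k →+* MvPowerSeries (Fin 2) k)]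
  have htail : coeff (Finsupp.single i (qOf p d)) (g₂ ^ qOf p d) = 0 := by
    apply coeff_of_lt_order
    have hle : ((2 * qOf p d : ℕ) : ℕ∞) ≤ (g₂ ^ qOf p d).order := by
      calc ((2 * qOf p d : ℕ) : ℕ∞) = qOf p d • (2 : ℕ∞) := by rw [Nat.cast_mul, nsmul_eq_mul]; push_cast; ring
        _ ≤ qOf p d • g₂.order := nsmul_le_nsmul_right h2 _
        _ ≤ _ := le_order_pow _
    refine lt_of_lt_of_le ?_ hle
    rw [Finsupp.degree_single]
    exact_mod_cast (by omega : qOf p d < 2 * qOf p d)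
  rw [hpow, map_add, map_add, htail, add_zero, coeff_C_mul, coeff_C_mul, coeff_X_pow, coeff_X_pow]
  fin_cases i
  · simp [Finsupp.single_eq_single_iff, hq.ne', hc₀]
  · simp [Finsupp.single_eq_single_iff, hq.ne', hc₁]

end QSlot

/-- Hence: if `[x_i] g ≠ 0` then the axis point `d!·e_i` is a scaled Newton point of `shift d A g` (slot `d − q`, exponent `q·e_i`). -/
theorem single_factorial_mem_newtonSet_shift (p : ℕ) [Fact p.Prime] [CharP k p] (hd : 0 < d) {A : Fin d → MvPowerSeries (Fin 2) k}
    (hA : IsPos d A)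
    {g : MvPowerSeries (Fin 2) k} (hg : constantCoeff g = 0) {i : Fin 2} (hc : coeff (Finsupp.single i 1) g ≠ 0) :
    Finsupp.single i d.factorial ∈ newtonSet (shift d A g) := by
  have hq := qOf_pos p d
  have hqd : qOf p d ≤ d := Nat.le_of_dvd hd (qOf_dvd p d)
  have hcoeff : coeff (Finsupp.single i (qOf p d)) (shift d A g (qSlot p d hd)) ≠ 0 := by
    rw [coeff_single_qOf_shift_qSlot p hd hA hg i]
    refine mul_ne_zero ?_ (pow_ne_zero _ hc)
    rw [Nat.choose_symm hqd]
    exact natCast_choose_qOf_ne_zero p hd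
  have hmem := smul_mem_newtonSet (shift d A g) (qSlot p d hd) hcoeff
  have hpt : slotWeight d (qSlot p d hd) • Finsupp.single i (qOf p d) = Finsupp.single i d.factorial := by
    rw [Finsupp.smul_single, smul_eq_mul]
    congr 1
    have h := slotWeight_mul_sub (qSlot p d hd)
    have hdj : d - ((qSlot p d hd : Fin d) : ℕ) = qOf p d := by show d - (d - qOf p d) = qOf p d; omega
    rw [hdj] at h
    exact h
  rw [hpt] at hmem
  exact hmem

/-! ### `x_i`-divisibility under `x_i`-multiple re-centrings -/

/-- If `x_i^{(d−j)m} ∣ B_j` for every slot and `x_i^m ∣ γ`, then `x_i^{(d−j)m} ∣ (shift d B γ)_j` for every slot. -/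
theorem X_pow_dvd_shift {B : Fin d → MvPowerSeries (Fin 2) k} {i : Fin 2} {m : ℕ}
    (hB : ∀ j : Fin d, X i ^ ((d - (j : ℕ)) * m) ∣ B j) {γ : MvPowerSeries (Fin 2) k} (hγ : X i ^ m ∣ γ) (j : Fin d) :
    X i ^ ((d - (j : ℕ)) * m) ∣ shift d B γ j := by
  rw [shift_eq]
  refine dvd_add ?_ (Finset.dvd_sum fun l _ => ?_)
  · refine Dvd.dvd.mul_left ?_ _
    rw [mul_comm, pow_mul]
    exact pow_dvd_pow_of_dvd hγ _
  · by_cases hlj : (l : ℕ) < j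
    · rw [Nat.choose_eq_zero_of_lt hlj, Nat.cast_zero, zero_mul, zero_mul]
      exact dvd_zero _
    · push Not at hlj
      have h1 : X i ^ ((d - (l : ℕ)) * m) ∣ B l := hB l
      have h2 : X i ^ (((l : ℕ) - j) * m) ∣ γ ^ ((l : ℕ) - j) := by
        rw [mul_comm, pow_mul]
        exact pow_dvd_pow_of_dvd hγ _
      have h12 : X i ^ ((d - (j : ℕ)) * m) ∣ B l * γ ^ ((l : ℕ) - j) := by
        have hl := l.2
        have hexp : (d - (j : ℕ)) * m = (d - (l : ℕ)) * m + ((l : ℕ) - j) * m := by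
          rw [← Nat.add_mul]; congr 1; omega
        rw [hexp, pow_add]
        exact mul_dvd_mul h1 h2
      rw [mul_assoc]
      exact Dvd.dvd.mul_left h12 _

/-! ### Corner elimination -/

section Corner

variable {S : Type*} [CommRing S]

/-- THE TUPLE OF `(y + c)^d` RE-CENTRED BY `−c` IS ZERO: `shift d (C(d,·) c^{d−·}) (−c) = 0`
(polynomial identity `((Y − c) + c)^d = Y^d`). -/
theorem shift_binomialTuple_neg_eq_zero (c : S) : shift d (fun j : Fin d => (d.choose (j : ℕ) : S) * c ^ (d - (j : ℕ))) (-c) = 0 := by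
  have hpoly : monicPoly d (fun j : Fin d => (d.choose (j : ℕ) : S) * c ^ (d - (j : ℕ))) = (Polynomial.X + Polynomial.C c) ^ d := by
    apply Polynomial.ext
    intro n
    rw [Polynomial.coeff_X_add_C_pow]
    rcases Nat.lt_trichotomy n d with hlt | rfl | hgt
    · rw [coeff_monicPoly_of_lt d _ ⟨n, hlt⟩, mul_comm]
    · rw [coeff_monicPoly_self, Nat.choose_self, Nat.sub_self, pow_zero, Nat.cast_one, one_mul]
    · rw [coeff_monicPoly_of_gt d _ hgt, Nat.choose_eq_zero_of_lt hgt, Nat.cast_zero, mul_zero]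
  funext j
  show (Polynomial.taylor (-c) (monicPoly d _)).coeff (j : ℕ) = 0
  rw [hpoly, Polynomial.taylor_apply, Polynomial.pow_comp, Polynomial.add_comp, Polynomial.X_comp, Polynomial.C_comp, map_neg,
    neg_add_cancel_right, Polynomial.coeff_X_pow, if_neg (ne_of_lt j.2)]

/-- THE SHIFT IS AFFINE IN THE TUPLE: `shift d (I + R) γ j = shift d I γ j + Σ_l C(l,j) R_l γ^{l−j}`. -/
theorem shift_add_apply (I R : Fin d → S) (γ : S) (j : Fin d) :
    shift d (I + R) γ j = shift d I γ j + ∑ l : Fin d, ((l : ℕ).choose j : S) * R l * γ ^ ((l : ℕ) - j) := by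
  rw [shift_eq, shift_eq, add_assoc, ← Finset.sum_add_distrib]
  congr 1
  refine Finset.sum_congr rfl fun l _ => ?_
  rw [Pi.add_apply]
  ring

end Corner

/-- **CORNER ELIMINATION.**  Let every monomial `β` of `B_l` dominate `(d−l)·v` and let the corner coefficients be
`[x^{(d−l)v}] B_l = C(d,l)(−μ)^{d−l}` (the `v`-corner part of `y^d + Σ_l B_l y^l` is `(y − μ x^v)^d`).  Then after the re-centring
`y ↦ y + μ x^v` every monomial `e` of every slot `j` of the new tuple STRICTLY dominates `(d−j)·v`: the corner is eliminated and nothing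
appears below it. -/
theorem corner_elimination {B : Fin d → MvPowerSeries (Fin 2) k} {v : Fin 2 →₀ ℕ} {μ : k}
    (hdom : ∀ (l : Fin d) (β : Fin 2 →₀ ℕ), coeff β (B l) ≠ 0 → (d - (l : ℕ)) • v ≤ β)
    (hcorner : ∀ l : Fin d, coeff ((d - (l : ℕ)) • v) (B l) = ((d.choose (l : ℕ) : ℕ) : k) * (-μ) ^ (d - (l : ℕ)))
    (j : Fin d) (e : Fin 2 →₀ ℕ) (he : coeff e (shift d B (monomial v μ) j) ≠ 0) :
    (d - (j : ℕ)) • v ≤ e ∧ e ≠ (d - (j : ℕ)) • v := by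
  classical
  -- the corner part `I` and the rest `R`
  set c : MvPowerSeries (Fin 2) k := monomial v (-μ) with hc
  let I : Fin d → MvPowerSeries (Fin 2) k := fun l => ((d.choose (l : ℕ) : ℕ) : MvPowerSeries (Fin 2) k) * c ^ (d - (l : ℕ))
  let R : Fin d → MvPowerSeries (Fin 2) k := fun l => B l - I l
  have hBIR : B = I + R := by funext l; simp [I, R]
  have hG : (monomial v μ : MvPowerSeries (Fin 2) k) = -c := by rw [hc, map_neg, neg_neg]
  have hI0 : shift d I (monomial v μ) = 0 := by
    rw [hG]
    have h := shift_binomialTuple_neg_eq_zero (d := d) c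
    convert h using 2
  -- coefficients of the corner part
  have hcpow : ∀ n : ℕ, c ^ n = monomial (n • v) ((-μ) ^ n) := fun n => by rw [hc, monomial_pow]
  have hIcoeff : ∀ (l : Fin d) (β : Fin 2 →₀ ℕ), coeff β (I l) = if β = (d - (l : ℕ)) • v then
      ((d.choose (l : ℕ) : ℕ) : k) * (-μ) ^ (d - (l : ℕ)) else 0 := by
    intro l β
    show coeff β (((d.choose (l : ℕ) : ℕ) : MvPowerSeries (Fin 2) k) * c ^ (d - (l : ℕ))) = _
    rw [← map_natCast (C : k →+* MvPowerSeries (Fin 2) k), coeff_C_mul, hcpow, coeff_monomial]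
    split_ifs <;> simp
  have hRcorner : ∀ l : Fin d, coeff ((d - (l : ℕ)) • v) (R l) = 0 := by
    intro l
    show coeff ((d - (l : ℕ)) • v) (B l - I l) = 0
    rw [map_sub, hcorner, hIcoeff, if_pos rfl, sub_self]
  have hRB : ∀ (l : Fin d) (β : Fin 2 →₀ ℕ), β ≠ (d - (l : ℕ)) • v → coeff β (R l) = coeff β (B l) := by
    intro l β hβ
    show coeff β (B l - I l) = coeff β (B l)
    rw [map_sub, hIcoeff, if_neg hβ, sub_zero]
  -- the shifted tuple is the `R`-sum
  rw [hBIR, shift_add_apply, hI0, Pi.zero_apply, zero_add, map_sum] at he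
  obtain ⟨l, -, hl⟩ := Finset.exists_ne_zero_of_sum_ne_zero he
  -- unfold the coefficient of `C(l,j) R_l G^{l-j}`
  rw [monomial_pow, coeff_mul_monomial] at hl
  split_ifs at hl with hle
  swap
  · exact absurd rfl hl
  have hne1 : coeff (e - ((l : ℕ) - j) • v) ((((l : ℕ).choose j : ℕ) : MvPowerSeries (Fin 2) k) * R l) ≠ 0 :=
    left_ne_zero_of_mul hl
  rw [← map_natCast (C : k →+* MvPowerSeries (Fin 2) k), coeff_C_mul] at hne1
  have hchoose : (((l : ℕ).choose j : ℕ) : k) ≠ 0 := left_ne_zero_of_mul hne1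
  have hjl : (j : ℕ) ≤ l := by
    by_contra hlt
    push Not at hlt
    exact hchoose (by rw [Nat.choose_eq_zero_of_lt hlt, Nat.cast_zero])
  have hRne : coeff (e - ((l : ℕ) - j) • v) (R l) ≠ 0 := right_ne_zero_of_mul hne1
  set β := e - ((l : ℕ) - j) • v with hβdef
  have hβne : β ≠ (d - (l : ℕ)) • v := fun h => hRne (by rw [h]; exact hRcorner l)
  rw [hRB l β hβne] at hRne
  have hβdom : (d - (l : ℕ)) • v ≤ β := hdom l β hRne
  have heq : e = β + ((l : ℕ) - j) • v := (tsub_add_cancel_of_le hle).symm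
  have hsplit : (d - (j : ℕ)) • v = (d - (l : ℕ)) • v + ((l : ℕ) - j) • v := by
    rw [← add_nsmul]; congr 1; have := l.2; omega
  rw [heq, hsplit]
  refine ⟨add_le_add_left hβdom _, fun h => hβne ?_⟩
  exact add_right_cancel h

end WildMonic

end Summit.ResolutionOfSingularities.ResolutionOfSingularities.Theorems

end
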